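import Summits.QuantumFields.YangMills.Theorems.BalabanUVNodesN11CRLetteredMemberLettersZ
import Summits.QuantumFields.YangMills.Theorems.BalabanUVNodesN11BgRowGaugeLiftOfPowM
import Literature.MathematicalPhysics.QuantumFieldTheory.Balaban1983to89.Node00.Record12BgRowCoClassGaugeRGuardedBRowAllTorus
import Literature.MathematicalPhysics.QuantumFieldTheory.Balaban1983to89.Node00.LargeFieldBackgroundCoPOfRecordB

/-!
# DAG node N11 × K0 — K0⁷'s DOOR PROVISOS + THE GUARD-FREE ROW `bg` AT THE cR-LETTERED z-MEMBER (DEF-1's Z family) OVER PRINT'S [II] (2.3) DATUM: the `(Adm, lamDatum F, Dat, UbgMSCoPOfRecordB)`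
# twin of this seat's `…N11K0DoorAtCRLetteredNumericsZ` §2–§4 (g5 p644729), the Stage-2 SEAM displayed as ONE hypothesis `hseam`, the (7) transfer as `hDat` — green BEFORE and AFTER the seam edit

HEADER — WORK-UNIT METADATA.  Cell `pub-ymgap`, YM-PLAN Track A, seat `pub-ymgap-dag-n11-w3` (g6); TRAIN-N11 of CLAIM-BOARD (iii-b) (director-ym №343 (D5)∕(D6), №346 (3), №348 (C));
dag-n11-d's RUNBOOK §4 (a)∕§5; keyed on k0-s1-w1's ✓p766329 `Node00/Record12BgRowCoClassGaugeRGuardedBRowAllTorus`, node00-def-R's S2b ✓p766661, dag-n11-d's ✓p767169 §7.3; the `hseam`∕`hDat`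
display is k0-s1-w1's ZBLam ∕ dag-n11-w1's SocketsGB pattern.  `--kind proof --supports stmt-QuantumFields-20541 --as helper` (count-neutral).  THEOREMS ONLY (0 `def`).  [III] =
[Balaban1988Convergent], [15] = [Balaban1985Variational], [6] = [Balaban1985RegularSpaces], [II] = [Balaban1984PropagatorsII], [I] = [Balaban1987RG1], [IV] = [Balaban1989LargeFieldI].

HONESTY GUARD (№338 (5)).  PURELY ADDITIVE print-datum twin of `…N11K0DoorAtCRLetteredNumericsZ` §2–§3 (FLAG №16 ∕ LOCATE-HSEAM 5d3298b8d191f169); the (b)-instance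
(`bgSepCoPAt_ccmwCRZ_of_thm1GaugeR_of_hcomp_allTorus`, `provisos₁₃SepCoP(H_door)_ccmwCRZ_…`) stays landed and true on its own text; nothing there is edited; no displayed premise is
deleted or weakened — the (8)∕(9) sentences become the guarded `(bd, Dat)` sentences of S1a-C ∕ S1b-2 (∕ S1b-1's step token), the guard is discharged by the displayed `hAdm`, the datum is
print's `lamDatum F` (= F0a's `lamBondsSeq`, `rfl`), and the seam is the displayed `hseam`.

WHY ∕ WHAT (token-pass of `…N11K0DoorAtCRLetteredNumericsB` to the z-member `θ = θ₁₃ᶻ(n_c, ε₂₉; Efl, logz)`, `n_c := {θ₁₅ᶜᶜᴹᵂ(j; γ)'s numerics with s2.cR := c}`, `0 < c ≤ 8`; see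
that file's header for the rationale — the (b) z-file reads the seam at `rw [UbgOfRecord₁₃CoP_succ]` (:266); here the row is proved over S2b's `UbgMSCoPOfRecordB` with the seam
DISPLAYED as `hseam : ∀ θ' p n s W, UbgOfRecord₁₃CoP F N θ' p (n+1) s W = UbgMSCoPOfRecordB …` (NOT provable pre-seam, NOT claimed) and the (7) transfer as `hDat`; 0 `def`, 0 `sorry`):
§1 ★ `bgAtDatumBg_ccmwCRZ_of_thm1GaugeGB_of_hcomp_allTorus` (row P11 at a Stage-13 background at the z-member, `(Adm, bd, Dat)`-generic, background-generic, guard by `hAdm`; k0-s1-w1's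
all-torus ᴮ row with the (b) z-file's §1 letters) · §2 ★★ `bgSepCoPAt_ccmwCRZ_of_thm1GaugeGB_of_hcomp_allTorus_lam` (K0a's socket shape from (8)ᴮ∕(9)ᴮ at `(Adm, lamDatum F, Dat)` + `hAdm`
+ `hDat` + `hseam`) · §3 ★★★ `provisos₁₃SepCoP_ccmwCRZ_…_lam` (K0a's DEF-1∕Z socket ∘ §2) · ★★★★ `provisos₁₃SepCoPH_door_ccmwCRZ_of_gauge9TopStepGB_of_betaBoxSignFree_allTorus_lam` (the
history-blind door from Part 14 §0c's hypotheses with the ᴮ tokens, β-box at the z-witness) · §4 ★ `hAdm_gridGuard_ccmwCRZ` + the `hAdm`-free door at k0's candidate guard A‴(c₁₅, c₀, c₁);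
v1.1 `hAdm_floorGuard_ccmwCRZ` · §5 (v1.1) ★★ `bgProvisoΛ_ccmwCRZ_…_of_hjm_lam` ∕ `bgFacts_ccmwCRZH_…_of_hjm_lam` — the GUARD-FREE row at the z-member over print's datum (twin of the (b)
z-file's §4: dag-n11-d's §7.3 + `hcubeΩ_of_powM`, `hseam` displayed, dag-n11-w1's `hadm`∕`hDat` shapes) + `hadm_floorGuard_ccmwCRZ`.

v1.2 — RESIDUE-FREE RE-POINT (director-ym №365 RENAME-AND-REDIRECT; CLASS-S shape: imports + `open` + proof tokens only, EVERY STATEMENT BYTE-IDENTICAL): the member's §1 letters are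
now read from this seat's residue-free `Thm/…N11CRLetteredMemberLettersZ` bundle (and the lift from dag-n11-w1's ✓p768576 residue-free `…BgRowGaugeLiftOfPowM` (powM edition of §7.3)) (`letters_ccmwCRZ` ∕ `hC1_letter_ccmwCRZ`) instead of the Stage-2 residue module
`…N11K0DoorAtCRLetteredNumericsZ` (which this file no longer imports), so this twin stays GREEN after the seam.

HONEST FRAMING ∕ A6.  Helper lane, count-neutral KERNEL BOOKKEEPING (applications BY NAME of k0-s1-w1's ∕ node00-def-R's ∕ node00-def-K0a's engines + the (b) file's arithmetic letters);
CONDITIONAL on `hseam` (the Stage-2 seam — NOT in the tree at filing time), `hDat`, the two ᴮ [15] sentences ∕ the ᴮ step token and the β-box (K0⁷'s stub territory — CANDIDATE texts, V23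
NOT registered), all DISPLAYED, never asserted; nothing of Bałaban ([III] ∕ [15] ∕ [6] ∕ [I]) asserted or discharged; NOT a re-pin (no `def`).  K0⁷ stub 1 NOT closed; N11 NOT discharged;
counts unmoved (typed 28∕28 · discharged 8∕27 · A 8∕28) · K 1∕4.  One finite `𝕋⁴_{L^K}` programme at fixed `ε = L^{−K}`; `route-QuantumFields-BalabanUVNodes` closes ONLY the CONDITIONAL
finite-𝕋⁴ rung `BalabanLadder.UV` — NOT ℝ⁴, NOT OS, NOT the Yang–Mills mass gap (Clay).  No `sorry`, no `axiom`, no `def`, no `instance`, no `notation`.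
Sources (SHAPE only): [III] Thm 1 p.262, (2.1) p.254, (2.3)–(2.8) pp.255–256, (2.10) p.256, (2.12)–(2.13) pp.256–257, (2.18) p.257, (2.25)–(2.28) pp.258–259, (2.34)–(2.41) p.261, (3.16)–(3.23) pp.268–270; [15] (6)–(7) p.278,
Thm 1 (8)–(9) p.279, (144)–(152) pp.300–301, Prop. 8 p.304; [6] (1.3)–(1.9) p.77; [II] (2.3) p.224; [I] Thm 1 p.259, (0.1) p.251, (0.20) p.256, (1.12) p.262, (1.20)–(1.22) p.264; [IV] (0.2)–(0.4) p.176; [LF-II] (1.4) p.357.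
-/

noncomputable section

open MeasureTheory
open scoped Matrix.Norms.L2Operator

namespace Summit.QuantumFields.YangMills.Theorems.BalabanUVNodesN11K0DoorAtCRLetteredNumericsZB

open Literature.MathematicalPhysics.QuantumFieldTheory.Balaban1983to89 Node00
open T4Continuum B14.Eq218Concrete B15DeterminingSets B15DeterminingSetsB FlowStep FlowStepRuns B12RegularSpaces111 B14RegularSpaces234
open BalabanUVNodesN11CRLetteredMemberLettersZ (letters_ccmwCRZ hC1_letter_ccmwCRZ)

variable {F : T4Family} {N : ℕ} [NeZero N] {j c₁₅ c₀ c₁ : ℕ} {γ c ε₀ ε₂₉ B₃ B₃' a₀ a₁ : ℝ} {Efl logz : B12.RunParams → ℕ → ℝ} {θ : Stage13Params F N}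
  {Adm : StepGuard F} {bd : BondDatum F} {Dat : TopData F N}

/-! ## §1  ★ Row P11 at a Stage-13 background AT THE MEMBER — `(Adm, bd, Dat)`-generic, background-generic, guard discharged by `hAdm` -/

section BgRowGeneric

/-- **★ ROW P11 AT A STAGE-13 BACKGROUND `Ubg p n s 𝐖` AT THE cR-LETTERED MEMBER ON EVERY PREFIX `(p, n, s)` (`n ≤ p.K`, window, `PartCompat₁₃`, separated `s`), FROM THE GUARDED
`(bd, Dat)` SENTENCES (8) `VariationalThm1RegSepCoP7MGB … Adm bd Dat …` (S1a-C) AND (9) `VariationalThm1GaugeRegSepCoP7MGB … (L^j) Adm bd Dat …` (S1b-2), the guard discharge `hAdm`,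
the background's `bd`-spec dichotomy `hbg`, and (hcomp) ∧ (hcompRev), for `0 < c ≤ 8`, `0 < γ ≤ ½`, ON EVERY FAMILY** — k0-s1-w1's ✓p766329
`Stage13Params.bgAtDatumBg_of_thm1RegSepCoP7MGB_of_thm1GaugeGB_allTorus` AT THE MEMBER with the (b) file's §1 letters (`hnum ∕ εreg ∕ hBα ∕ htI ∕ htMS ∕ hC1_ccmwCRZ`), `hMa := ⟨j, rfl⟩`,
`0 < M₁ = L^j`.  CONDITIONAL on the two `Prop`s (hypotheses); nothing of Bałaban asserted.
[cite: Balaban1985Variational, (6)–(7) p.278, Thm 1 (8)–(9) p.279, Prop. 8 p.304, p.304 lines 1–2; Balaban1985RegularSpaces, (1.3)–(1.9) p.77; Balaban1984PropagatorsII, (2.3) p.224; Balaban1988Convergent, Thm 1 p.262, (2.1) p.254, (2.4)–(2.8) pp.255–256, (2.10) p.256, (2.12)–(2.13) pp.256–257, p.257, (2.27)–(2.28) p.259, (2.34)–(2.41) p.261; Balaban1987RG1, (0.1) p.251, (1.12) p.262] -/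
theorem bgAtDatumBg_ccmwCRZ_of_thm1GaugeGB_of_hcomp_allTorus (hθ : θ = theta13LiveOfNumericsZ F N
      ({ stage12NumericsOfThm1CCMW F.L j γ ε₀ B₃ B₃' a₀ a₁ with s2 := { sect2NumericsOfThm1C F.L with cR := c } } : Stage12Numerics) ε₂₉
      (zeta316OfRecord F N (stage12NumericsOfThm1CCMW F.L j γ ε₀ B₃ B₃' a₀ a₁).ν (stage12NumericsOfThm1CCMW F.L j γ ε₀ B₃ B₃' a₀ a₁).τ9.M
        (stage12NumericsOfThm1CCMW F.L j γ ε₀ B₃ B₃' a₀ a₁).A₁) (RzOfRecord F N) (ZtOfRecord F N) Efl logz)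
    (hc0 : 0 < c) (hc8 : c ≤ 8) (hγ0 : 0 < γ) (hγ : γ ≤ 1 / 2) (hε : 0 < ε₀) (hε' : 0 < ε₂₉) (hB : 0 ≤ B₃) (hB' : 0 ≤ B₃') (ha₀ : 0 < a₀) (ha₁ : 0 < a₁)
    (h15 : VariationalThm1RegSepCoP7MGB F N Adm bd Dat B₃ a₀ a₁) (h15G : VariationalThm1GaugeRegSepCoP7MGB F N (F.L ^ j) Adm bd Dat B₃ B₃' a₀ a₁)
    (hAdm : ∀ (p : B12.RunParams) (n : ℕ) (s : SeqOfRecord F θ.ν θ.τ9.M (gOfRecord₁₃ F N θ p) p.K n), 1 ≤ n → n ≤ p.K →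
      Step.InInterval θ.γ n (gOfRecord₁₃ F N θ p) → PartCompat₁₃ F N θ p n → Adm θ.ν θ.τ9.M (gOfRecord₁₃ F N θ p) p.K n s)
    (Ubg : (p : B12.RunParams) → (n : ℕ) → SeqOfRecord F θ.ν θ.τ9.M (gOfRecord₁₃ F N θ p) p.K n → MSField (F.P p.K) (SU N) → GaugeField (F.P p.K) 0 (SU N))
    (hbg : ∀ (p : B12.RunParams) (n : ℕ) (s : SeqOfRecord F θ.ν θ.τ9.M (gOfRecord₁₃ F N θ p) p.K n) (W : MSField (F.P p.K) (SU N)),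
      IsMinimizerB (avOfRecord F N p.K) (regMSCoPOfRecord F N θ.ν p.K n s.Ω) (bd p.K n s.Ω) W (Ubg p n s W) ∨ Ubg p n s W = 1)
    (hcomp : ∀ (p : B12.RunParams) (n : ℕ), n ≤ p.K → Step.InInterval θ.γ n (gOfRecord₁₃ F N θ p) → ∀ m, m < n →
      θ.s2.cR * epsOfRecord θ.ν (gOfRecord₁₃ F N θ p) m ≤ 2 * (θ.s2.cR * epsOfRecord θ.ν (gOfRecord₁₃ F N θ p) (m + 1)))
    (hcompRev : ∀ (p : B12.RunParams) (n : ℕ), n ≤ p.K → Step.InInterval θ.γ n (gOfRecord₁₃ F N θ p) → ∀ m, m < n →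
      θ.s2.cR * epsOfRecord θ.ν (gOfRecord₁₃ F N θ p) (m + 1) ≤ 2 * (θ.s2.cR * epsOfRecord θ.ν (gOfRecord₁₃ F N θ p) m)) :
    ∀ (p : B12.RunParams) (n : ℕ), n ≤ p.K → Step.InInterval θ.γ n (gOfRecord₁₃ F N θ p) → PartCompat₁₃ F N θ p n →
      ∀ s : SeqOfRecord F θ.ν θ.τ9.M (gOfRecord₁₃ F N θ p) p.K n, Sect2.SeqSeparated θ.ν.M₁ s → ∀ W : MSField (F.P p.K) (SU N),
      Dat p.K s.Ω (suppDomOfRecord F θ.ν p.K s.Ω) n (fun j' => θ.s2.cR * epsOfRecord θ.ν (gOfRecord₁₃ F N θ p) j') W →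
      ∀ j', 1 ≤ j' → j' ≤ n → ∀ X : (Sect2.domSys (F.P p.K) θ.τ9.M j').Dom,
      (Sect2.domSites (F.P p.K) θ.τ9.M j' X ⊆ s.Λ j' →
        Sect2.ofBackgroundC (settingOfRecord₁₃ F N θ p).ι (Ubg p n s W) ∈
          Sect2.spaceI (settingOfRecord₁₃ F N θ p) (θ.Rz p.K) θ.τ9.M j' (Sect2.domSites (F.P p.K) θ.τ9.M j' X)
            ((settingOfRecord₁₃ F N θ p).lf.alpha0 ((settingOfRecord₁₃ F N θ p).flow.g j')) ((settingOfRecord₁₃ F N θ p).lf.alpha1 ((settingOfRecord₁₃ F N θ p).flow.g j'))) ∧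
      (Sect2.admB (F.P p.K) θ.ν θ.τ9.M (gOfRecord₁₃ F N θ p) s.Ω s.Λ j' (Sect2.domSites (F.P p.K) θ.τ9.M j' X) = true →
        Sect2.ofBackgroundC (settingOfRecord₁₃ F N θ p).ι (Ubg p n s W) ∈
          Sect2.spaceMS (settingOfRecord₁₃ F N θ p) (θ.Rz p.K) θ.τ9.M j' (Sect2.domSites (F.P p.K) θ.τ9.M j' X) s.Ω) := by
  obtain ⟨hnum, hεreg, hBα, htI, htMS, hC1, -, -, -, -⟩ := letters_ccmwCRZ hθ hc0 hc8 hγ hB hB' ha₀ ha₁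
  subst hθ
  have hγ1 : γ < 1 := hγ.trans_lt (by norm_num)
  have hpos : ({ stage12NumericsOfThm1CCMW F.L j γ ε₀ B₃ B₃' a₀ a₁ with s2 := { sect2NumericsOfThm1C F.L with cR := c } } : Stage12Numerics).Pos := by
    obtain ⟨h1, h2, h3, h4, h5, h6, -, h8, h9⟩ := stage12NumericsOfThm1CCMW_pos (j := j) F.hL.2.le hγ0 hγ1 hε hB hB' ha₀ ha₁
    exact ⟨h1, h2, h3, h4, h5, h6, hc0, h8, h9⟩
  have hadm := (admissible_theta13OfNumericsZ
    (n := ({ stage12NumericsOfThm1CCMW F.L j γ ε₀ B₃ B₃' a₀ a₁ with s2 := { sect2NumericsOfThm1C F.L with cR := c } } : Stage12Numerics)) F N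
    (zeta316OfRecord F N (stage12NumericsOfThm1CCMW F.L j γ ε₀ B₃ B₃' a₀ a₁).ν (stage12NumericsOfThm1CCMW F.L j γ ε₀ B₃ B₃' a₀ a₁).τ9.M
      (stage12NumericsOfThm1CCMW F.L j γ ε₀ B₃ B₃' a₀ a₁).A₁) (RzOfRecord F N) (ZtOfRecord F N) Efl logz hpos hε').liveRepin₁₃
  intro p n hn hw hpc s hsep W h7
  exact Stage13Params.bgAtDatumBg_of_thm1RegSepCoP7MGB_of_thm1GaugeGB_allTorus _ hadm rfl
    (show 0 < F.L ^ j from pow_pos (by have := F.hL11; omega) _) h15 h15G Ubg hbg hnum hεreg hcomp hcompRev hBα htI htMS hC1 ⟨j, rfl⟩ hAdm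
    p n hn hw hpc s hsep (show 0 < F.L ^ j from pow_pos (by have := F.hL11; omega) _) W h7

end BgRowGeneric

/-! ## §2  ★★ The `Provisos₁₃SepCoP`-shaped row AT THE MEMBER over print's datum: `UbgMSCoPOfRecordB` ∘ `hseam`, data transfer `hDat` -/

section BgRowLam

/-- **★★ THE (7)-GUARDED SEPARATED ROW P11 AT THE Co CARRIER AT THE cR-LETTERED MEMBER — SOCKET SHAPE (`W ∈ suppOfRecord₁₃P`, `Sect2.DataSmall7PTop`, background `UbgOfRecord₁₃CoP`
BY NAME) — FROM (8)ᴮ `VariationalThm1RegSepCoP7MGB F N Adm (lamDatum F) Dat`, (9)ᴮ `VariationalThm1GaugeRegSepCoP7MGB F N (L^j) Adm (lamDatum F) Dat`, `hAdm`, `hDat`, `hseam`,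
(hcomp) ∧ (hcompRev), `0 < c ≤ 8`, `0 < γ ≤ ½`, ON EVERY FAMILY**: §1 at `Ubg := UbgMSCoPOfRecordB …`, `bd := lamDatum F` (`= lamBondsSeq`, `rfl`), `hbg := ubgMSCoPOfRecordB_dichotomy`
(S2b), data by `hDat` at the torus-compatible prefix, then `rw [hseam]`; at `n = 0` the window of scales `1 ≤ j' ≤ 0` is empty.  Statement = the (b) file's §2 with the two (b) sentences
replaced and `hAdm ∕ hDat ∕ hseam` added.  CONDITIONAL; nothing of Bałaban asserted; `hseam` NOT provable before the seam edit and NOT claimed.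
[cite: Balaban1985Variational, (6)–(7) p.278, Thm 1 (8)–(9) p.279, (144)–(152) pp.300–301, Prop. 8 p.304; Balaban1985RegularSpaces, (1.3)–(1.9) p.77; Balaban1984PropagatorsII, (2.3) p.224; Balaban1988Convergent, Thm 1 p.262, (2.1) p.254, (2.4)–(2.8) pp.255–256, (2.10) p.256, (2.12)–(2.13) pp.256–257, (2.18) p.257, (2.25)–(2.28) pp.258–259; Balaban1987RG1, Thm 1 p.259, (0.1) p.251, (1.12) p.262] -/
theorem bgSepCoPAt_ccmwCRZ_of_thm1GaugeGB_of_hcomp_allTorus_lam (hθ : θ = theta13LiveOfNumericsZ F N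
      ({ stage12NumericsOfThm1CCMW F.L j γ ε₀ B₃ B₃' a₀ a₁ with s2 := { sect2NumericsOfThm1C F.L with cR := c } } : Stage12Numerics) ε₂₉
      (zeta316OfRecord F N (stage12NumericsOfThm1CCMW F.L j γ ε₀ B₃ B₃' a₀ a₁).ν (stage12NumericsOfThm1CCMW F.L j γ ε₀ B₃ B₃' a₀ a₁).τ9.M
        (stage12NumericsOfThm1CCMW F.L j γ ε₀ B₃ B₃' a₀ a₁).A₁) (RzOfRecord F N) (ZtOfRecord F N) Efl logz)
    (hc0 : 0 < c) (hc8 : c ≤ 8) (hγ0 : 0 < γ) (hγ : γ ≤ 1 / 2) (hε : 0 < ε₀) (hε' : 0 < ε₂₉) (hB : 0 ≤ B₃) (hB' : 0 ≤ B₃') (ha₀ : 0 < a₀) (ha₁ : 0 < a₁)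
    (h15 : VariationalThm1RegSepCoP7MGB F N Adm (lamDatum F) Dat B₃ a₀ a₁) (h15G : VariationalThm1GaugeRegSepCoP7MGB F N (F.L ^ j) Adm (lamDatum F) Dat B₃ B₃' a₀ a₁)
    (hAdm : ∀ (p : B12.RunParams) (n : ℕ) (s : SeqOfRecord F θ.ν θ.τ9.M (gOfRecord₁₃ F N θ p) p.K n), 1 ≤ n → n ≤ p.K →
      Step.InInterval θ.γ n (gOfRecord₁₃ F N θ p) → PartCompat₁₃ F N θ p n → Adm θ.ν θ.τ9.M (gOfRecord₁₃ F N θ p) p.K n s)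
    (hDat : ∀ (θ' : Stage13Params F N) (p : B12.RunParams) (n : ℕ) (s : SeqOfRecord F θ'.ν θ'.τ9.M (gOfRecord₁₃ F N θ' p) p.K n) (δ : ℕ → ℝ) (W : MSField (F.P p.K) (SU N)),
      n ≤ p.K → PartCompat₁₃ F N θ' p n →
      Sect2.DataSmall7PTop (avOfRecord F N p.K) s.Ω (suppDomOfRecord F θ'.ν p.K s.Ω) n δ W → Dat p.K s.Ω (suppDomOfRecord F θ'.ν p.K s.Ω) n δ W)
    (hseam : ∀ (θ' : Stage13Params F N) (p : B12.RunParams) (n : ℕ) (s : SeqOfRecord F θ'.ν θ'.τ9.M (gOfRecord₁₃ F N θ' p) p.K (n + 1)) (W : MSField (F.P p.K) (SU N)),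
      UbgOfRecord₁₃CoP F N θ' p (n + 1) s W = UbgMSCoPOfRecordB F N θ'.ν θ'.τ9.M (gOfRecord₁₃ F N θ' p) p.K (n + 1) s W)
    (hcomp : ∀ (p : B12.RunParams) (n : ℕ), n ≤ p.K → Step.InInterval θ.γ n (gOfRecord₁₃ F N θ p) → ∀ m, m < n →
      θ.s2.cR * epsOfRecord θ.ν (gOfRecord₁₃ F N θ p) m ≤ 2 * (θ.s2.cR * epsOfRecord θ.ν (gOfRecord₁₃ F N θ p) (m + 1)))
    (hcompRev : ∀ (p : B12.RunParams) (n : ℕ), n ≤ p.K → Step.InInterval θ.γ n (gOfRecord₁₃ F N θ p) → ∀ m, m < n →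
      θ.s2.cR * epsOfRecord θ.ν (gOfRecord₁₃ F N θ p) (m + 1) ≤ 2 * (θ.s2.cR * epsOfRecord θ.ν (gOfRecord₁₃ F N θ p) m)) :
    ∀ (p : B12.RunParams) (n : ℕ), n ≤ p.K → Step.InInterval θ.γ n (gOfRecord₁₃ F N θ p) → PartCompat₁₃ F N θ p n →
      ∀ s : SeqOfRecord F θ.ν θ.τ9.M (gOfRecord₁₃ F N θ p) p.K n, Sect2.SeqSeparated θ.ν.M₁ s →
      ∀ W : MSField (F.P p.K) (SU N), W ∈ suppOfRecord₁₃P F N θ p n s →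
      Sect2.DataSmall7PTop (avOfRecord F N p.K) s.Ω (suppDomOfRecord F θ.ν p.K s.Ω) n (fun j' => θ.s2.cR * epsOfRecord θ.ν (gOfRecord₁₃ F N θ p) j') W →
      ∀ j', 1 ≤ j' → j' ≤ n → ∀ X : (Sect2.domSys (F.P p.K) θ.τ9.M j').Dom,
      (Sect2.domSites (F.P p.K) θ.τ9.M j' X ⊆ s.Λ j' →
        Sect2.ofBackgroundC (settingOfRecord₁₃ F N θ p).ι (UbgOfRecord₁₃CoP F N θ p n s W) ∈
          Sect2.spaceI (settingOfRecord₁₃ F N θ p) (θ.Rz p.K) θ.τ9.M j' (Sect2.domSites (F.P p.K) θ.τ9.M j' X)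
            ((settingOfRecord₁₃ F N θ p).lf.alpha0 ((settingOfRecord₁₃ F N θ p).flow.g j')) ((settingOfRecord₁₃ F N θ p).lf.alpha1 ((settingOfRecord₁₃ F N θ p).flow.g j'))) ∧
      (Sect2.admB (F.P p.K) θ.ν θ.τ9.M (gOfRecord₁₃ F N θ p) s.Ω s.Λ j' (Sect2.domSites (F.P p.K) θ.τ9.M j' X) = true →
        Sect2.ofBackgroundC (settingOfRecord₁₃ F N θ p).ι (UbgOfRecord₁₃CoP F N θ p n s W) ∈
          Sect2.spaceMS (settingOfRecord₁₃ F N θ p) (θ.Rz p.K) θ.τ9.M j' (Sect2.domSites (F.P p.K) θ.τ9.M j' X) s.Ω) := by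
  have H := bgAtDatumBg_ccmwCRZ_of_thm1GaugeGB_of_hcomp_allTorus hθ hc0 hc8 hγ0 hγ hε hε' hB hB' ha₀ ha₁ h15 h15G hAdm
    (fun p n s W => UbgMSCoPOfRecordB F N θ.ν θ.τ9.M (gOfRecord₁₃ F N θ p) p.K n s W)
    (fun p n s W => ubgMSCoPOfRecordB_dichotomy θ.ν θ.τ9.M (gOfRecord₁₃ F N θ p) p.K n s W) hcomp hcompRev
  intro p n hn hw hpc s hsep W _ h7
  cases n with
  | zero => intro j' h1 hj'; exfalso; omega
  | succ n =>
    rw [hseam]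
    exact H p (n + 1) hn hw hpc s hsep W (hDat θ p (n + 1) s _ W hn hpc h7)

end BgRowLam

/-! ## §3  ★★★★ K0⁷'s door provisos at the member over print's datum (Part 14 §0c's hypotheses with (8)∕(9) ↦ the ᴮ tokens, plus `hAdm`, `hDat`, `hseam`, `0 < c ≤ 8`) -/

section Door

/-- **★★★ `Provisos₁₃SepCoP` AT THE MEMBER FROM (8)ᴮ, (9)ᴮ, `hAdm`, `hDat`, `hseam` AND (hcomp) ∧ (hcompRev), ON EVERY FAMILY** — node00-def-K0a's generic socket
`provisos₁₃SepCoP_theta13LiveOfNumerics_of_bgSepCoP` ∘ §2 (`hM := ⟨j, rfl⟩`, `hM₁ := dvd_refl`).  CONDITIONAL; nothing of Bałaban asserted.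
[cite: Balaban1985Variational, Thm 1 (8)–(9) p.279, (152) p.301; Balaban1984PropagatorsII, (2.3) p.224; Balaban1988Convergent, Thm 1 p.262, (2.7) p.255, (2.12) p.256, (2.28) p.259, (3.16)–(3.22) pp.268–269; Balaban1985RegularSpaces, (1.3)–(1.9) p.77] -/
theorem provisos₁₃SepCoP_ccmwCRZ_of_thm1GaugeGB_of_hcomp_allTorus_lam (hθ : θ = theta13LiveOfNumericsZ F N
      ({ stage12NumericsOfThm1CCMW F.L j γ ε₀ B₃ B₃' a₀ a₁ with s2 := { sect2NumericsOfThm1C F.L with cR := c } } : Stage12Numerics) ε₂₉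
      (zeta316OfRecord F N (stage12NumericsOfThm1CCMW F.L j γ ε₀ B₃ B₃' a₀ a₁).ν (stage12NumericsOfThm1CCMW F.L j γ ε₀ B₃ B₃' a₀ a₁).τ9.M
        (stage12NumericsOfThm1CCMW F.L j γ ε₀ B₃ B₃' a₀ a₁).A₁) (RzOfRecord F N) (ZtOfRecord F N) Efl logz)
    (hc0 : 0 < c) (hc8 : c ≤ 8) (hγ0 : 0 < γ) (hγ : γ ≤ 1 / 2) (hε : 0 < ε₀) (hε' : 0 < ε₂₉) (hB : 0 ≤ B₃) (hB' : 0 ≤ B₃') (ha₀ : 0 < a₀) (ha₁ : 0 < a₁)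
    (h15 : VariationalThm1RegSepCoP7MGB F N Adm (lamDatum F) Dat B₃ a₀ a₁) (h15G : VariationalThm1GaugeRegSepCoP7MGB F N (F.L ^ j) Adm (lamDatum F) Dat B₃ B₃' a₀ a₁)
    (hAdm : ∀ (p : B12.RunParams) (n : ℕ) (s : SeqOfRecord F θ.ν θ.τ9.M (gOfRecord₁₃ F N θ p) p.K n), 1 ≤ n → n ≤ p.K →
      Step.InInterval θ.γ n (gOfRecord₁₃ F N θ p) → PartCompat₁₃ F N θ p n → Adm θ.ν θ.τ9.M (gOfRecord₁₃ F N θ p) p.K n s)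
    (hDat : ∀ (θ' : Stage13Params F N) (p : B12.RunParams) (n : ℕ) (s : SeqOfRecord F θ'.ν θ'.τ9.M (gOfRecord₁₃ F N θ' p) p.K n) (δ : ℕ → ℝ) (W : MSField (F.P p.K) (SU N)),
      n ≤ p.K → PartCompat₁₃ F N θ' p n →
      Sect2.DataSmall7PTop (avOfRecord F N p.K) s.Ω (suppDomOfRecord F θ'.ν p.K s.Ω) n δ W → Dat p.K s.Ω (suppDomOfRecord F θ'.ν p.K s.Ω) n δ W)
    (hseam : ∀ (θ' : Stage13Params F N) (p : B12.RunParams) (n : ℕ) (s : SeqOfRecord F θ'.ν θ'.τ9.M (gOfRecord₁₃ F N θ' p) p.K (n + 1)) (W : MSField (F.P p.K) (SU N)),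
      UbgOfRecord₁₃CoP F N θ' p (n + 1) s W = UbgMSCoPOfRecordB F N θ'.ν θ'.τ9.M (gOfRecord₁₃ F N θ' p) p.K (n + 1) s W)
    (hcomp : ∀ (p : B12.RunParams) (n : ℕ), n ≤ p.K → Step.InInterval θ.γ n (gOfRecord₁₃ F N θ p) → ∀ m, m < n →
      θ.s2.cR * epsOfRecord θ.ν (gOfRecord₁₃ F N θ p) m ≤ 2 * (θ.s2.cR * epsOfRecord θ.ν (gOfRecord₁₃ F N θ p) (m + 1)))
    (hcompRev : ∀ (p : B12.RunParams) (n : ℕ), n ≤ p.K → Step.InInterval θ.γ n (gOfRecord₁₃ F N θ p) → ∀ m, m < n →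
      θ.s2.cR * epsOfRecord θ.ν (gOfRecord₁₃ F N θ p) (m + 1) ≤ 2 * (θ.s2.cR * epsOfRecord θ.ν (gOfRecord₁₃ F N θ p) m)) :
    θ.Provisos₁₃SepCoP F N := by
  have hbg := bgSepCoPAt_ccmwCRZ_of_thm1GaugeGB_of_hcomp_allTorus_lam hθ hc0 hc8 hγ0 hγ hε hε' hB hB' ha₀ ha₁ h15 h15G hAdm hDat hseam hcomp hcompRev
  subst hθ
  exact (theta13OfNumericsZ F N
    ({ stage12NumericsOfThm1CCMW F.L j γ ε₀ B₃ B₃' a₀ a₁ with s2 := { sect2NumericsOfThm1C F.L with cR := c } } : Stage12Numerics) ε₂₉ _ _ _ Efl logz).provisos₁₃SepCoP_liveRepin₁₃_of_bgSepCoP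
    (hasResidualsOfRecord_theta13OfNumericsZ F N _ ε₂₉ Efl logz) ⟨j, rfl⟩ (dvd_refl _) hbg

/-- **★★★★ K0⁷'s DOOR PROVISOS AT THE HISTORY-BLIND DOOR OVER THE CURED cR-LETTERED MEMBER OVER PRINT'S DATUM, FROM dag-n24-c PART 14 §0c's HYPOTHESES WITH THE (b) SENTENCES
REPLACED BY THE ᴮ TOKENS** (`0 < γ ≤ ½`, the six signs, (8)ᴮ `VariationalThm1RegSepCoP7MGB F N Adm (lamDatum F) Dat B₃ a₀ a₁` (S1a-C), [15] Sect. F's (9)-step ᴮ token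
`Gauge9RegSepTopStepGB F N suppDomOfRecord (L^j) Adm (lamDatum F) Dat B₃ B₃' a₀ a₁` (S1b-1, through S1b-2's `variationalThm1GaugeRegSepCoP7MGB_of_gauge9TopStepGB`), the SIGN-FREE windowed
β-box `BetaLowerH bₗ γ ∕ BetaUpperH β′ γ` OF `betaOfRecord₁₃ F N θ₁₅ᶜᶜᴹᵂ(j; γ)` (`c`-blind, unchanged) with `−bₗ·γ² ≤ 3`, `β′·γ² ≤ ¾`) **PLUS `hAdm`, `hDat`, `hseam` AND `0 < c ≤ 8`**.
CONDITIONAL on the displayed sentences (K0⁷'s stub territory, CANDIDATE texts) and on `hseam`; nothing of Bałaban asserted.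
[cite: Balaban1985Variational, Thm 1 (8)–(9) p.279, (144)–(152) pp.300–301, Prop. 8 p.304; Balaban1984PropagatorsII, (2.3) p.224; Balaban1988Convergent, Thm 1 p.262, (2.6)–(2.8) pp.255–256, (2.10) p.256, (2.21) p.258, (3.16)–(3.23) pp.268–270; Balaban1987RG1, Thm 1 p.259, (0.1) p.251, (0.20) p.256, (1.20)–(1.22) p.264; Balaban1989LargeFieldI, (0.2)–(0.4) p.176; Balaban1989LargeFieldII, (1.4) p.357] -/
theorem provisos₁₃SepCoPH_door_ccmwCRZ_of_gauge9TopStepGB_of_betaBoxSignFree_allTorus_lam (hθ : θ = theta13LiveOfNumericsZ F N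
      ({ stage12NumericsOfThm1CCMW F.L j γ ε₀ B₃ B₃' a₀ a₁ with s2 := { sect2NumericsOfThm1C F.L with cR := c } } : Stage12Numerics) ε₂₉
      (zeta316OfRecord F N (stage12NumericsOfThm1CCMW F.L j γ ε₀ B₃ B₃' a₀ a₁).ν (stage12NumericsOfThm1CCMW F.L j γ ε₀ B₃ B₃' a₀ a₁).τ9.M
        (stage12NumericsOfThm1CCMW F.L j γ ε₀ B₃ B₃' a₀ a₁).A₁) (RzOfRecord F N) (ZtOfRecord F N) Efl logz)
    (hc0 : 0 < c) (hc8 : c ≤ 8) (hγ0 : 0 < γ) (hγ : γ ≤ 1 / 2) (hε : 0 < ε₀) (hε' : 0 < ε₂₉) (hB : 0 ≤ B₃) (hB' : 0 ≤ B₃') (ha₀ : 0 < a₀) (ha₁ : 0 < a₁)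
    (h15 : VariationalThm1RegSepCoP7MGB F N Adm (lamDatum F) Dat B₃ a₀ a₁)
    (h9 : Gauge9RegSepTopStepGB F N (fun ν K Ω => suppDomOfRecord F ν K Ω) (F.L ^ j) Adm (lamDatum F) Dat B₃ B₃' a₀ a₁)
    (hAdm : ∀ (p : B12.RunParams) (n : ℕ) (s : SeqOfRecord F θ.ν θ.τ9.M (gOfRecord₁₃ F N θ p) p.K n), 1 ≤ n → n ≤ p.K →
      Step.InInterval θ.γ n (gOfRecord₁₃ F N θ p) → PartCompat₁₃ F N θ p n → Adm θ.ν θ.τ9.M (gOfRecord₁₃ F N θ p) p.K n s)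
    (hDat : ∀ (θ' : Stage13Params F N) (p : B12.RunParams) (n : ℕ) (s : SeqOfRecord F θ'.ν θ'.τ9.M (gOfRecord₁₃ F N θ' p) p.K n) (δ : ℕ → ℝ) (W : MSField (F.P p.K) (SU N)),
      n ≤ p.K → PartCompat₁₃ F N θ' p n →
      Sect2.DataSmall7PTop (avOfRecord F N p.K) s.Ω (suppDomOfRecord F θ'.ν p.K s.Ω) n δ W → Dat p.K s.Ω (suppDomOfRecord F θ'.ν p.K s.Ω) n δ W)
    (hseam : ∀ (θ' : Stage13Params F N) (p : B12.RunParams) (n : ℕ) (s : SeqOfRecord F θ'.ν θ'.τ9.M (gOfRecord₁₃ F N θ' p) p.K (n + 1)) (W : MSField (F.P p.K) (SU N)),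
      UbgOfRecord₁₃CoP F N θ' p (n + 1) s W = UbgMSCoPOfRecordB F N θ'.ν θ'.τ9.M (gOfRecord₁₃ F N θ' p) p.K (n + 1) s W)
    {bl β' : ℝ} (hbox : BetaLowerH bl γ (betaOfRecord₁₃ F N (theta13OfThm1CCMWZ F N j γ ε₀ ε₂₉ B₃ B₃' a₀ a₁ Efl logz)))
    (hbox' : BetaUpperH β' γ (betaOfRecord₁₃ F N (theta13OfThm1CCMWZ F N j γ ε₀ ε₂₉ B₃ B₃' a₀ a₁ Efl logz))) (hl : -bl * γ ^ 2 ≤ 3) (hβ' : β' * γ ^ 2 ≤ 3 / 4) :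
    (Stage13HParams.ofHistoryBlind F N ⟨θ, ZrOfRecord₁₃ F N θ⟩).Provisos₁₃SepCoPH F N :=
  have H := (letters_ccmwCRZ hθ hc0 hc8 hγ hB hB' ha₀ ha₁).2.2.2.2.2.2.2.2.2 hbox hbox' hl hβ'
  (provisos₁₃SepCoP_ccmwCRZ_of_thm1GaugeGB_of_hcomp_allTorus_lam hθ hc0 hc8 hγ0 hγ hε hε' hB hB' ha₀ ha₁ h15
    (variationalThm1GaugeRegSepCoP7MGB_of_gauge9TopStepGB h9) hAdm hDat hseam H.1 H.2).ofCured.ofHistoryBlind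

end Door

/-! ## §4  ★ The guard hypothesis DISCHARGED at the member for the four-conjunct CANDIDATE guard `A‴(c₁₅, c₀, c₁)`, and the `hAdm`-free door -/

section GridGuard

/-- **★ `hAdm` AT THE cR-LETTERED MEMBER FOR THE FOUR-CONJUNCT CANDIDATE GUARD** `A‴(c₁₅, c₀, c₁) := fun ν M g K k _ => c₁₅ ≤ ν.M₁ ∧ k + c₀ ≤ F.m + K ∧ F.L ^ c₁ ∣ M ∧ ∀ i, 1 ≤ i → i ≤ k →
dCubeSide (F.P K).L M (RkOfRecord (F.P K).L ν.r (g i)) i ∣ (F.P K).sitesPerDir 0` (k0-s1-w3 ∕ k0-s1-w1's `…GuardedZB(Lam)` text) from `c₁₅ ≤ L^j`, `c₀ ≤ j + 1`, `c₁ ≤ j`, at every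
torus-compatible run of the window: the floor (`ν.M₁ = L^j`, `rfl`), the level letter `n + j + 1 ≤ F.m + p.K` (from `PartCompat₁₃` ∧ (C1) `hC1_ccmwCRZ`: `L^{n+j+1} ∣ 2·L^{m+K}`, `L` odd — w1's
ZBLam §1 arithmetic VERBATIM), the cube letter (`τ9.M = L^j`, `rfl`), and (C2) = `PartCompat₁₃` ITSELF.  Pure arithmetic; nothing of Bałaban asserted.
[cite: Balaban1988Convergent, (2.1) p.254, (2.5) p.255, p.257; Balaban1985RegularSpaces, (1.3)–(1.6) p.77; Balaban1985Variational, p.304 lines 1–2; Balaban1987RG1, (0.1) p.251, (1.12) p.262] -/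
theorem hAdm_gridGuard_ccmwCRZ (hθ : θ = theta13LiveOfNumericsZ F N
      ({ stage12NumericsOfThm1CCMW F.L j γ ε₀ B₃ B₃' a₀ a₁ with s2 := { sect2NumericsOfThm1C F.L with cR := c } } : Stage12Numerics) ε₂₉
      (zeta316OfRecord F N (stage12NumericsOfThm1CCMW F.L j γ ε₀ B₃ B₃' a₀ a₁).ν (stage12NumericsOfThm1CCMW F.L j γ ε₀ B₃ B₃' a₀ a₁).τ9.M
        (stage12NumericsOfThm1CCMW F.L j γ ε₀ B₃ B₃' a₀ a₁).A₁) (RzOfRecord F N) (ZtOfRecord F N) Efl logz) (hγ : γ ≤ 1 / 2)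
    (hc₁₅ : c₁₅ ≤ F.L ^ j) (hc₀ : c₀ ≤ j + 1) (hc₁ : c₁ ≤ j) :
    ∀ (p : B12.RunParams) (n : ℕ) (s : SeqOfRecord F θ.ν θ.τ9.M (gOfRecord₁₃ F N θ p) p.K n), 1 ≤ n → n ≤ p.K →
      Step.InInterval θ.γ n (gOfRecord₁₃ F N θ p) → PartCompat₁₃ F N θ p n →
      (fun (ν : Stage7Numerics) (M : ℕ) (g : ℕ → ℝ) (K k : ℕ) (_s : SeqOfRecord F ν M g K k) => c₁₅ ≤ ν.M₁ ∧ k + c₀ ≤ F.m + K ∧ F.L ^ c₁ ∣ M ∧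
        ∀ i, 1 ≤ i → i ≤ k → dCubeSide (F.P K).L M (RkOfRecord (F.P K).L ν.r (g i)) i ∣ (F.P K).sitesPerDir 0) θ.ν θ.τ9.M (gOfRecord₁₃ F N θ p) p.K n s := by
  have hC1 := (hC1_letter_ccmwCRZ hθ hγ).1
  have hMa : θ.τ9.M = F.L ^ j := by subst hθ; rfl
  have hM₁ : θ.ν.M₁ = F.L ^ j := by subst hθ; rfl
  intro p n s hn1 hn hw hpc
  have hC1' := hC1 p n hn hw
  -- the level letter at this torus-compatible run (`L^e ∣ 2·L^f ⇒ e ≤ f` for `L` odd `> 1`, then `PartCompat₁₃` ∧ (C1)) — k0-s1-w1's ZBLam §1 arithmetic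
  have hcop : ∀ e f : ℕ, F.L ^ e ∣ 2 * F.L ^ f → e ≤ f := fun e f h =>
    (Nat.pow_dvd_pow_iff_le_right F.hL.2).mp ((Nat.Coprime.pow_left e (Odd.coprime_two_right F.hL.1)).dvd_of_dvd_mul_left h)
  have hlev : ∀ n', 1 ≤ n' → n' ≤ n → n' + j + 1 ≤ F.m + p.K := by
    intro n' h1 hn'
    obtain ⟨t, _, hR⟩ := hC1' n' h1 hn'
    have hdvd := hpc n' h1 hn'
    rw [hR, hMa] at hdvd
    have hd : F.L ^ n' * F.L ^ j * (F.L * t) ∣ 2 * F.L ^ (F.m + p.K - 0) := hdvd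
    rw [Nat.sub_zero] at hd
    exact hcop _ _ ((Dvd.intro t (by ring) : F.L ^ (n' + j + 1) ∣ F.L ^ n' * F.L ^ j * (F.L * t)).trans hd)
  refine ⟨?_, ?_, ?_, hpc⟩
  · rw [hM₁]; exact hc₁₅
  · have h := hlev n hn1 le_rfl; omega
  · rw [hMa]; exact pow_dvd_pow F.L hc₁

/-- **★★★★ K0⁷'s DOOR PROVISOS AT THE MEMBER OVER PRINT'S DATUM UNDER THE CANDIDATE GUARD `A‴(c₁₅, c₀, c₁)`, `hAdm`-FREE** — §3's door with `hAdm := hAdm_gridGuard_ccmwCRZ` (`c₁₅ ≤ L^j`,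
`c₀ ≤ j + 1`, `c₁ ≤ j`): the N11 door a V23-shaped K0 body (k0-s1-w1 `…GuardedZBLam` §5: stub 1ᴮ `Prop8RegSepTopStepGB F N suppDom A‴ (lamDatum F) Dat …`, the (9)-supplier over the ᴮ
tokens, stub 3ᴬ′) feeds BY NAME at the `c := 2` member, where N11's K0-rows road is non-vacuous.  CONDITIONAL on the displayed tokens, `hDat` and `hseam`; nothing of Bałaban asserted.
[cite: Balaban1985Variational, Thm 1 (8)–(9) p.279, (144)–(152) pp.300–301, Prop. 8 p.304, p.304 lines 1–2; Balaban1985RegularSpaces, (1.3)–(1.6) p.77; Balaban1984PropagatorsII, (2.3) p.224; Balaban1988Convergent, Thm 1 p.262, (2.1) p.254, (2.5)–(2.8) pp.255–256, (2.10) p.256, p.257, (3.16)–(3.23) pp.268–270; Balaban1987RG1, Thm 1 p.259, (0.1) p.251, (0.20) p.256, (1.12) p.262, (1.20)–(1.22) p.264; Balaban1989LargeFieldI, (0.2)–(0.4) p.176; Balaban1989LargeFieldII, (1.4) p.357] -/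
theorem provisos₁₃SepCoPH_door_ccmwCRZ_gridGuard_of_gauge9TopStepGB_of_betaBoxSignFree_allTorus_lam (hθ : θ = theta13LiveOfNumericsZ F N
      ({ stage12NumericsOfThm1CCMW F.L j γ ε₀ B₃ B₃' a₀ a₁ with s2 := { sect2NumericsOfThm1C F.L with cR := c } } : Stage12Numerics) ε₂₉
      (zeta316OfRecord F N (stage12NumericsOfThm1CCMW F.L j γ ε₀ B₃ B₃' a₀ a₁).ν (stage12NumericsOfThm1CCMW F.L j γ ε₀ B₃ B₃' a₀ a₁).τ9.M
        (stage12NumericsOfThm1CCMW F.L j γ ε₀ B₃ B₃' a₀ a₁).A₁) (RzOfRecord F N) (ZtOfRecord F N) Efl logz)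
    (hc0 : 0 < c) (hc8 : c ≤ 8) (hγ0 : 0 < γ) (hγ : γ ≤ 1 / 2) (hε : 0 < ε₀) (hε' : 0 < ε₂₉) (hB : 0 ≤ B₃) (hB' : 0 ≤ B₃') (ha₀ : 0 < a₀) (ha₁ : 0 < a₁)
    (hc₁₅ : c₁₅ ≤ F.L ^ j) (hc₀ : c₀ ≤ j + 1) (hc₁ : c₁ ≤ j)
    (h15 : VariationalThm1RegSepCoP7MGB F N (fun ν M g K k _s => c₁₅ ≤ ν.M₁ ∧ k + c₀ ≤ F.m + K ∧ F.L ^ c₁ ∣ M ∧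
      ∀ i, 1 ≤ i → i ≤ k → dCubeSide (F.P K).L M (RkOfRecord (F.P K).L ν.r (g i)) i ∣ (F.P K).sitesPerDir 0) (lamDatum F) Dat B₃ a₀ a₁)
    (h9 : Gauge9RegSepTopStepGB F N (fun ν K Ω => suppDomOfRecord F ν K Ω) (F.L ^ j) (fun ν M g K k _s => c₁₅ ≤ ν.M₁ ∧ k + c₀ ≤ F.m + K ∧ F.L ^ c₁ ∣ M ∧
      ∀ i, 1 ≤ i → i ≤ k → dCubeSide (F.P K).L M (RkOfRecord (F.P K).L ν.r (g i)) i ∣ (F.P K).sitesPerDir 0) (lamDatum F) Dat B₃ B₃' a₀ a₁)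
    (hDat : ∀ (θ' : Stage13Params F N) (p : B12.RunParams) (n : ℕ) (s : SeqOfRecord F θ'.ν θ'.τ9.M (gOfRecord₁₃ F N θ' p) p.K n) (δ : ℕ → ℝ) (W : MSField (F.P p.K) (SU N)),
      n ≤ p.K → PartCompat₁₃ F N θ' p n →
      Sect2.DataSmall7PTop (avOfRecord F N p.K) s.Ω (suppDomOfRecord F θ'.ν p.K s.Ω) n δ W → Dat p.K s.Ω (suppDomOfRecord F θ'.ν p.K s.Ω) n δ W)
    (hseam : ∀ (θ' : Stage13Params F N) (p : B12.RunParams) (n : ℕ) (s : SeqOfRecord F θ'.ν θ'.τ9.M (gOfRecord₁₃ F N θ' p) p.K (n + 1)) (W : MSField (F.P p.K) (SU N)),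
      UbgOfRecord₁₃CoP F N θ' p (n + 1) s W = UbgMSCoPOfRecordB F N θ'.ν θ'.τ9.M (gOfRecord₁₃ F N θ' p) p.K (n + 1) s W)
    {bl β' : ℝ} (hbox : BetaLowerH bl γ (betaOfRecord₁₃ F N (theta13OfThm1CCMWZ F N j γ ε₀ ε₂₉ B₃ B₃' a₀ a₁ Efl logz)))
    (hbox' : BetaUpperH β' γ (betaOfRecord₁₃ F N (theta13OfThm1CCMWZ F N j γ ε₀ ε₂₉ B₃ B₃' a₀ a₁ Efl logz))) (hl : -bl * γ ^ 2 ≤ 3) (hβ' : β' * γ ^ 2 ≤ 3 / 4) :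
    (Stage13HParams.ofHistoryBlind F N ⟨θ, ZrOfRecord₁₃ F N θ⟩).Provisos₁₃SepCoPH F N :=
  provisos₁₃SepCoPH_door_ccmwCRZ_of_gauge9TopStepGB_of_betaBoxSignFree_allTorus_lam hθ hc0 hc8 hγ0 hγ hε hε' hB hB' ha₀ ha₁ h15 h9
    (hAdm_gridGuard_ccmwCRZ hθ hγ hc₁₅ hc₀ hc₁) hDat hseam hbox hbox' hl hβ'


/-- **`hAdm` AT THE z-MEMBER FOR THE FLOOR GUARD `floorGuard F c₁₅`** (the legacy R road of the consumers that also read the guard-free row: dag-n11-w1's R-road convention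
`Adm := floorGuard F c₁₅` with the floor letter `hc₁₅ : c₁₅ ≤ L^j` kept): at the member `ν.M₁ = L^j` (`rfl`), so the §1–§3 guard discharge `hAdm` at `Adm := floorGuard F c₁₅` IS `hc₁₅`
(the window ∕ `PartCompat₁₃` antecedents unused).  v1.1 addition for the member cone's CLASS-T consumers. [cite: Balaban1985RegularSpaces, (1.3)–(1.6) p.77; Balaban1985Variational, p.304 lines 1–2 (bookkeeping)] -/
theorem hAdm_floorGuard_ccmwCRZ (hθ : θ = theta13LiveOfNumericsZ F N
      ({ stage12NumericsOfThm1CCMW F.L j γ ε₀ B₃ B₃' a₀ a₁ with s2 := { sect2NumericsOfThm1C F.L with cR := c } } : Stage12Numerics) ε₂₉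
      (zeta316OfRecord F N (stage12NumericsOfThm1CCMW F.L j γ ε₀ B₃ B₃' a₀ a₁).ν (stage12NumericsOfThm1CCMW F.L j γ ε₀ B₃ B₃' a₀ a₁).τ9.M
        (stage12NumericsOfThm1CCMW F.L j γ ε₀ B₃ B₃' a₀ a₁).A₁) (RzOfRecord F N) (ZtOfRecord F N) Efl logz) (hc₁₅ : c₁₅ ≤ F.L ^ j) :
    ∀ (p : B12.RunParams) (n : ℕ) (s : SeqOfRecord F θ.ν θ.τ9.M (gOfRecord₁₃ F N θ p) p.K n), 1 ≤ n → n ≤ p.K →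
      Step.InInterval θ.γ n (gOfRecord₁₃ F N θ p) → PartCompat₁₃ F N θ p n → floorGuard F c₁₅ θ.ν θ.τ9.M (gOfRecord₁₃ F N θ p) p.K n s := by
  have hM₁ : θ.ν.M₁ = F.L ^ j := by subst hθ; rfl
  intro p n s _ _ _ _
  exact (floorGuard_apply c₁₅ θ.ν θ.τ9.M (gOfRecord₁₃ F N θ p) p.K n s).mpr (hM₁ ▸ hc₁₅)

end GridGuard


/-! ## §5  (v1.1) The GUARD-FREE row `bg` at the z-member over print's datum (`hseam` displayed) — twin of the (b) z-file's §4; guard row `hadm` and transfer `hDat` in dag-n11-w1's shapes -/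

section GuardFreeLam

open BalabanUVNodesN11BgRowGaugeLiftOfPowM (stage13_bgAtDatumBg_of_thm1RegSepCoP7MGB_of_thm1GaugeGB_of_powM)

/-- **(v1.1) ★★ ROW P11 `bg` IN ITS OWN CURRENCY AT THE cR-LETTERED z-MEMBER ON EVERY WINDOW RUN — NO RUN GUARD — OVER PRINT'S DATUM, `hseam` DISPLAYED**: `BgProvisoΛ …` from (8)ᴮ∕(9)ᴮ at
`(Adm, lamDatum F, Dat)` + `hadm` + `hDat` (dag-n11-w1's shapes) + `hseam` + (hcomp) ∧ (hcompRev): dag-n11-d's §7.3 at the z-member with `Ubg := UbgMSCoPOfRecordB`, `hbg := ubgMSCoPOfRecordB_dichotomy`,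
(v1.2: dag-n11-w1's powM lift, `M = L^j` `rfl`, (C1) `hC1_ccmwCRZ`), `hsN := hsN_theta13OfThm1CCMWZ hjm`, `rw [hseam]` — the twin (and kernel check of the campaign re-key) of the (b) z-file's §4.  CONDITIONAL; nothing asserted.
[cite: Balaban1988Convergent, (2.28) p.259, (2.18) p.257, Thm 1 p.262, (2.4)–(2.8) pp.255–256, (2.10) p.256; Balaban1985Variational, (6)–(7) p.278, Thm 1 (8)–(9) p.279; Balaban1985RegularSpaces, (1.3)–(1.6) p.77; Balaban1984PropagatorsII, (2.3) p.224; Balaban1987RG1, Thm 1 p.259, (1.12) p.262] -/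
theorem bgProvisoΛ_ccmwCRZ_of_thm1GaugeGB_of_hcomp_of_hjm_lam (hθ : θ = theta13LiveOfNumericsZ F N
      ({ stage12NumericsOfThm1CCMW F.L j γ ε₀ B₃ B₃' a₀ a₁ with s2 := { sect2NumericsOfThm1C F.L with cR := c } } : Stage12Numerics) ε₂₉
      (zeta316OfRecord F N (stage12NumericsOfThm1CCMW F.L j γ ε₀ B₃ B₃' a₀ a₁).ν (stage12NumericsOfThm1CCMW F.L j γ ε₀ B₃ B₃' a₀ a₁).τ9.M
        (stage12NumericsOfThm1CCMW F.L j γ ε₀ B₃ B₃' a₀ a₁).A₁) (RzOfRecord F N) (ZtOfRecord F N) Efl logz)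
    (hjm : j + 1 ≤ F.m) (hc0 : 0 < c) (hc8 : c ≤ 8) (hγ0 : 0 < γ) (hγ : γ ≤ 1 / 2) (hε : 0 < ε₀) (hε' : 0 < ε₂₉) (hB : 0 ≤ B₃) (hB' : 0 ≤ B₃') (ha₀ : 0 < a₀) (ha₁ : 0 < a₁)
    (h15 : VariationalThm1RegSepCoP7MGB F N Adm (lamDatum F) Dat B₃ a₀ a₁) (h15G : VariationalThm1GaugeRegSepCoP7MGB F N (F.L ^ j) Adm (lamDatum F) Dat B₃ B₃' a₀ a₁)
    (hadm : ∀ (p : B12.RunParams) (n : ℕ), n ≤ p.K → Step.InInterval θ.γ n (gOfRecord₁₃ F N θ p) →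
      ∀ s : SeqOfRecord F θ.ν θ.τ9.M (gOfRecord₁₃ F N θ p) p.K n, Adm θ.ν θ.τ9.M (gOfRecord₁₃ F N θ p) p.K n s)
    (hDat : ∀ (p : B12.RunParams) (n : ℕ) (s : SeqOfRecord F θ.ν θ.τ9.M (gOfRecord₁₃ F N θ p) p.K n) (δ : ℕ → ℝ) (W : MSField (F.P p.K) (SU N)),
      n ≤ p.K → Step.InInterval θ.γ n (gOfRecord₁₃ F N θ p) →
      Sect2.DataSmall7PTop (avOfRecord F N p.K) s.Ω (suppDomOfRecord F θ.ν p.K s.Ω) n δ W → Dat p.K s.Ω (suppDomOfRecord F θ.ν p.K s.Ω) n δ W)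
    (hseam : ∀ (θ' : Stage13Params F N) (p : B12.RunParams) (n : ℕ) (s : SeqOfRecord F θ'.ν θ'.τ9.M (gOfRecord₁₃ F N θ' p) p.K (n + 1)) (W : MSField (F.P p.K) (SU N)),
      UbgOfRecord₁₃CoP F N θ' p (n + 1) s W = UbgMSCoPOfRecordB F N θ'.ν θ'.τ9.M (gOfRecord₁₃ F N θ' p) p.K (n + 1) s W)
    (hcomp : ∀ (p : B12.RunParams) (n : ℕ), n ≤ p.K → Step.InInterval θ.γ n (gOfRecord₁₃ F N θ p) → ∀ m, m < n →
      θ.s2.cR * epsOfRecord θ.ν (gOfRecord₁₃ F N θ p) m ≤ 2 * (θ.s2.cR * epsOfRecord θ.ν (gOfRecord₁₃ F N θ p) (m + 1)))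
    (hcompRev : ∀ (p : B12.RunParams) (n : ℕ), n ≤ p.K → Step.InInterval θ.γ n (gOfRecord₁₃ F N θ p) → ∀ m, m < n →
      θ.s2.cR * epsOfRecord θ.ν (gOfRecord₁₃ F N θ p) (m + 1) ≤ 2 * (θ.s2.cR * epsOfRecord θ.ν (gOfRecord₁₃ F N θ p) m)) :
    ∀ (p : B12.RunParams) (n : ℕ), n ≤ p.K → Step.InInterval θ.γ n (gOfRecord₁₃ F N θ p) →
      BgProvisoΛ F N p.K (settingOfRecord₁₃ F N θ p) (θ.Rz p.K) θ.τ9.M n (suppOfRecord₁₃SepCoP F N θ p n) (UbgOfRecord₁₃CoP F N θ p n) := by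
  obtain ⟨hnum, hεreg, hBα, htI, htMS, hC1, -, -, -, -⟩ := letters_ccmwCRZ hθ hc0 hc8 hγ hB hB' ha₀ ha₁
  subst hθ
  have hγ1 : γ < 1 := hγ.trans_lt (by norm_num)
  have hpos : ({ stage12NumericsOfThm1CCMW F.L j γ ε₀ B₃ B₃' a₀ a₁ with s2 := { sect2NumericsOfThm1C F.L with cR := c } } : Stage12Numerics).Pos := by
    obtain ⟨h1, h2, h3, h4, h5, h6, -, h8, h9⟩ := stage12NumericsOfThm1CCMW_pos (j := j) F.hL.2.le hγ0 hγ1 hε hB hB' ha₀ ha₁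
    exact ⟨h1, h2, h3, h4, h5, h6, hc0, h8, h9⟩
  have hθadm := (admissible_theta13OfNumericsZ
    (n := ({ stage12NumericsOfThm1CCMW F.L j γ ε₀ B₃ B₃' a₀ a₁ with s2 := { sect2NumericsOfThm1C F.L with cR := c } } : Stage12Numerics)) F N
    (zeta316OfRecord F N (stage12NumericsOfThm1CCMW F.L j γ ε₀ B₃ B₃' a₀ a₁).ν (stage12NumericsOfThm1CCMW F.L j γ ε₀ B₃ B₃' a₀ a₁).τ9.M
      (stage12NumericsOfThm1CCMW F.L j γ ε₀ B₃ B₃' a₀ a₁).A₁) (RzOfRecord F N) (ZtOfRecord F N) Efl logz hpos hε').liveRepin₁₃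
  intro p n hn hw s W hW
  cases n with
  | zero => intro j' h1 hj'; exfalso; omega
  | succ n =>
    rw [hseam]
    exact stage13_bgAtDatumBg_of_thm1RegSepCoP7MGB_of_thm1GaugeGB_of_powM _ hθadm rfl h15 h15G (fun p n s W => UbgMSCoPOfRecordB F N _ _ _ p.K n s W)
      (fun p n s W => ubgMSCoPOfRecordB_dichotomy _ _ _ p.K n s W) hnum hεreg hcomp hcompRev hBα htI htMS (a := j) rfl hC1 (hsN_theta13OfThm1CCMWZ F N γ ε₀ ε₂₉ B₃ B₃' a₀ a₁ Efl logz hjm)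
      p (n + 1) hn hw s hW.2.1 (show 0 < F.L ^ j from pow_pos (by have := F.hL11; omega) _) (hadm p (n + 1) hn hw s) W (hDat p (n + 1) s _ W hn hw hW.2.2)

/-- **(v1.1) ★★ THE `hbgs` BINDER OF dag-n11-w1's `…OfBgFacts` CONSUMERS AT EVERY H-EXTENSION OF THE z-MEMBER, EVERY WINDOW `γ' ≤ θ.γ`, OVER PRINT'S DATUM, `hseam` DISPLAYED** — the twin of
the (b) z-file's `bgFacts_ccmwCRZH_…`. [cite: Balaban1988Convergent, (2.28) p.259, Thm 1 p.262 (bookkeeping); Balaban1984PropagatorsII, (2.3) p.224] -/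
theorem bgFacts_ccmwCRZH_of_thm1GaugeGB_of_hcomp_of_hjm_lam {θH : Stage13HParams F N} (hH : θH.toStage13Params = θ) (hθ : θ = theta13LiveOfNumericsZ F N
      ({ stage12NumericsOfThm1CCMW F.L j γ ε₀ B₃ B₃' a₀ a₁ with s2 := { sect2NumericsOfThm1C F.L with cR := c } } : Stage12Numerics) ε₂₉
      (zeta316OfRecord F N (stage12NumericsOfThm1CCMW F.L j γ ε₀ B₃ B₃' a₀ a₁).ν (stage12NumericsOfThm1CCMW F.L j γ ε₀ B₃ B₃' a₀ a₁).τ9.M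
        (stage12NumericsOfThm1CCMW F.L j γ ε₀ B₃ B₃' a₀ a₁).A₁) (RzOfRecord F N) (ZtOfRecord F N) Efl logz)
    (hjm : j + 1 ≤ F.m) (hc0 : 0 < c) (hc8 : c ≤ 8) (hγ0 : 0 < γ) (hγ : γ ≤ 1 / 2) (hε : 0 < ε₀) (hε' : 0 < ε₂₉) (hB : 0 ≤ B₃) (hB' : 0 ≤ B₃') (ha₀ : 0 < a₀) (ha₁ : 0 < a₁)
    (h15 : VariationalThm1RegSepCoP7MGB F N Adm (lamDatum F) Dat B₃ a₀ a₁) (h15G : VariationalThm1GaugeRegSepCoP7MGB F N (F.L ^ j) Adm (lamDatum F) Dat B₃ B₃' a₀ a₁)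
    (hadm : ∀ (p : B12.RunParams) (n : ℕ), n ≤ p.K → Step.InInterval θ.γ n (gOfRecord₁₃ F N θ p) →
      ∀ s : SeqOfRecord F θ.ν θ.τ9.M (gOfRecord₁₃ F N θ p) p.K n, Adm θ.ν θ.τ9.M (gOfRecord₁₃ F N θ p) p.K n s)
    (hDat : ∀ (p : B12.RunParams) (n : ℕ) (s : SeqOfRecord F θ.ν θ.τ9.M (gOfRecord₁₃ F N θ p) p.K n) (δ : ℕ → ℝ) (W : MSField (F.P p.K) (SU N)),
      n ≤ p.K → Step.InInterval θ.γ n (gOfRecord₁₃ F N θ p) →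
      Sect2.DataSmall7PTop (avOfRecord F N p.K) s.Ω (suppDomOfRecord F θ.ν p.K s.Ω) n δ W → Dat p.K s.Ω (suppDomOfRecord F θ.ν p.K s.Ω) n δ W)
    (hseam : ∀ (θ' : Stage13Params F N) (p : B12.RunParams) (n : ℕ) (s : SeqOfRecord F θ'.ν θ'.τ9.M (gOfRecord₁₃ F N θ' p) p.K (n + 1)) (W : MSField (F.P p.K) (SU N)),
      UbgOfRecord₁₃CoP F N θ' p (n + 1) s W = UbgMSCoPOfRecordB F N θ'.ν θ'.τ9.M (gOfRecord₁₃ F N θ' p) p.K (n + 1) s W)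
    (hcomp : ∀ (p : B12.RunParams) (n : ℕ), n ≤ p.K → Step.InInterval θ.γ n (gOfRecord₁₃ F N θ p) → ∀ m, m < n →
      θ.s2.cR * epsOfRecord θ.ν (gOfRecord₁₃ F N θ p) m ≤ 2 * (θ.s2.cR * epsOfRecord θ.ν (gOfRecord₁₃ F N θ p) (m + 1)))
    (hcompRev : ∀ (p : B12.RunParams) (n : ℕ), n ≤ p.K → Step.InInterval θ.γ n (gOfRecord₁₃ F N θ p) → ∀ m, m < n →
      θ.s2.cR * epsOfRecord θ.ν (gOfRecord₁₃ F N θ p) (m + 1) ≤ 2 * (θ.s2.cR * epsOfRecord θ.ν (gOfRecord₁₃ F N θ p) m)) {γ' : ℝ} (hγ' : γ' ≤ θ.γ) :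
    ∀ P : B12.RunParams, Step.InInterval γ' P.K (gOfRecord₁₃ F N θH.toStage13Params P) → ∀ k, k ≤ P.K →
      BgProvisoΛ F N P.K (settingOfRecord₁₃ F N θH.toStage13Params P) (θH.Rz P.K) θH.τ9.M k (suppOfRecord₁₃SepCoP F N θH.toStage13Params P k)
        (UbgOfRecord₁₃CoP F N θH.toStage13Params P k) := by
  subst hH
  intro P hw k hk
  exact bgProvisoΛ_ccmwCRZ_of_thm1GaugeGB_of_hcomp_of_hjm_lam hθ hjm hc0 hc8 hγ0 hγ hε hε' hB hB' ha₀ ha₁ h15 h15G hadm hDat hseam hcomp hcompRev P k hk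
    (fun m hm => ⟨(hw m (hm.trans hk)).1, (hw m (hm.trans hk)).2.trans hγ'⟩)

/-- **(v1.1) `hadm` AT THE z-MEMBER FOR THE LEGACY FLOOR GUARD `floorGuard F c₁₅`** (dag-n11-w1's R-road convention): it IS `hc₁₅` (`ν.M₁ = L^j`, `rfl`). [cite: Balaban1985RegularSpaces, (1.3)–(1.6) p.77; Balaban1985Variational, p.304 lines 1–2 (bookkeeping)] -/
theorem hadm_floorGuard_ccmwCRZ (hθ : θ = theta13LiveOfNumericsZ F N
      ({ stage12NumericsOfThm1CCMW F.L j γ ε₀ B₃ B₃' a₀ a₁ with s2 := { sect2NumericsOfThm1C F.L with cR := c } } : Stage12Numerics) ε₂₉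
      (zeta316OfRecord F N (stage12NumericsOfThm1CCMW F.L j γ ε₀ B₃ B₃' a₀ a₁).ν (stage12NumericsOfThm1CCMW F.L j γ ε₀ B₃ B₃' a₀ a₁).τ9.M
        (stage12NumericsOfThm1CCMW F.L j γ ε₀ B₃ B₃' a₀ a₁).A₁) (RzOfRecord F N) (ZtOfRecord F N) Efl logz) (hc₁₅ : c₁₅ ≤ F.L ^ j) :
    ∀ (p : B12.RunParams) (n : ℕ), n ≤ p.K → Step.InInterval θ.γ n (gOfRecord₁₃ F N θ p) →
      ∀ s : SeqOfRecord F θ.ν θ.τ9.M (gOfRecord₁₃ F N θ p) p.K n, floorGuard F c₁₅ θ.ν θ.τ9.M (gOfRecord₁₃ F N θ p) p.K n s := by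
  have hM₁ : θ.ν.M₁ = F.L ^ j := by subst hθ; rfl
  intro p n _ _ s
  exact (floorGuard_apply c₁₅ θ.ν θ.τ9.M (gOfRecord₁₃ F N θ p) p.K n s).mpr (hM₁ ▸ hc₁₅)
end GuardFreeLam

end Summit.QuantumFields.YangMills.Theorems.BalabanUVNodesN11K0DoorAtCRLetteredNumericsZB

end
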